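import Summits.BirchSwinnertonDyer.BirchSwinnertonDyer.Theorems.EdixhovenFibreFiveSevenLTwistTransferWitnessIrrCore

/-!
# Transfer witness, general irreducible image — the `GL₂(𝔽_p)` argument, conclusion (route
# `EdixhovenFibreFiveSeven`, crux TDS57, `--supports`; ROAD A′ part 9)

Cell `pub/bsd-wall` (D-0145 line `route-BirchSwinnertonDyer-EdixhovenFibreFiveSeven`), seat `bsd-line-edix-p3`
(prover). THEOREMS ONLY (no definition, no named fact, no `sorry`); route-free. BSD is not proved by this file.

Continuation of `…WitnessIrrCore` (`structure_of_bad`: traces in `{0, ±2}`, no unipotents): under the same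
abstract hypotheses plus `(B)` (all `z C ρ(h)` of trace `±2`), `G = ⋃ ζ^a c₀^b H` and `det ρ(ζ) = 3`, a
contradiction (`false_of_bad`): `ρ(H) ⊆ {±1}` makes `ρ(G)` monomial and then diagonal (reducible); otherwise a
trace-zero `j ∈ ρ(H)` exists, the Fricke identity `3·tr(j z j z⁻¹) = −26` makes `z` commute with `j`,
anticommuting partners contradict `tr(zj) = ±4`, so the trace-zero part of `ρ(H)` is `{±j}`, and `C j C = ±j`
gives `tr(zC) = 0` (against `(B)`) or a diagonal `ρ(G)`.

References: [Serre1972] §2; [SilvermanAEC2009] III.7.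
-/

set_option autoImplicit false
-- the Theorems directory repeats the summit name (sibling precedent `SignedBaseChangeAssembly.lean`)
set_option linter.dupNamespace false

noncomputable section

open scoped Classical MatrixGroups

open Matrix

namespace Summit.BirchSwinnertonDyer.BirchSwinnertonDyer.Theorems.LTwistTransfer


/-- **No simultaneously bad fibres.** Under the abstract hypotheses (module docstring) it is impossible that
all `z ρ(h)`, `h ∈ H`, have trace `±4` and all `z C ρ(h)` have trace `±2`.
[cite: Serre1972, §2.6 (subgroups of GL₂(𝔽_p))] -/
theorem false_of_bad {p : ℕ} [Fact p.Prime] (hp57 : p = 5 ∨ p = 7)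
    {G : Type*} [Group G] (ρ : G →* Matrix (Fin 2) (Fin 2) (ZMod p)) (H : Subgroup G)
    (hHn : ∀ g : G, ∀ h ∈ H, g * h * g⁻¹ ∈ H) (hHc : ∀ g₁ g₂ : G, g₁ * g₂ * g₁⁻¹ * g₂⁻¹ ∈ H)
    (hdetH : ∀ h ∈ H, (ρ h).det = 1)
    (c₀ ζ : G) (hC : ρ c₀ = !![1, 0; 0, -1]) (hdetz : (ρ ζ).det = 3)
    (hgen : ∀ g : G, ∃ (a b : ℕ) (h : G), h ∈ H ∧ g = ζ ^ a * c₀ ^ b * h)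
    (hL1 : ∃ g, ρ g 1 0 ≠ 0)
    (hA : ∀ h ∈ H, (ρ ζ * ρ h) 0 0 + (ρ ζ * ρ h) 1 1 = 4 ∨ (ρ ζ * ρ h) 0 0 + (ρ ζ * ρ h) 1 1 = -4)
    (hB : ∀ h ∈ H, (ρ ζ * ρ c₀ * ρ h) 0 0 + (ρ ζ * ρ c₀ * ρ h) 1 1 = 2 ∨
      (ρ ζ * ρ c₀ * ρ h) 0 0 + (ρ ζ * ρ c₀ * ρ h) 1 1 = -2)
    (hL2 : ∃ g, ρ g 0 1 ≠ 0) : False := by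
  obtain ⟨h2, h3, h4, h6, h26, h32⟩ := numerals_ne_zero hp57
  set z := ρ ζ with hz
  set C := ρ c₀ with hCdef
  -- inverses
  have hinv : ∀ g : G, ρ g * ρ g⁻¹ = 1 ∧ ρ g⁻¹ * ρ g = 1 := fun g ↦
    ⟨by rw [← map_mul, mul_inv_cancel, map_one], by rw [← map_mul, inv_mul_cancel, map_one]⟩
  have hρinv : ∀ h ∈ H, ρ h⁻¹ = ((ρ h) 0 0 + (ρ h) 1 1) • (1 : Matrix (Fin 2) (Fin 2) (ZMod p)) - ρ h := by
    intro h hh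
    have h1 := mul_tr_smul_one_sub (ρ h) (hdetH h hh)
    calc ρ h⁻¹ = ρ h⁻¹ * (ρ h * (((ρ h) 0 0 + (ρ h) 1 1) • 1 - ρ h)) := by rw [h1, mul_one]
      _ = (ρ h⁻¹ * ρ h) * (((ρ h) 0 0 + (ρ h) 1 1) • 1 - ρ h) := by rw [mul_assoc]
      _ = _ := by rw [(hinv h).2, one_mul]
  have hC00 : C 0 0 = 1 := by rw [hC]; simp
  have hC01 : C 0 1 = 0 := by rw [hC]; simp
  have hC10 : C 1 0 = 0 := by rw [hC]; simp
  have hC11 : C 1 1 = -1 := by rw [hC]; simp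
  have hCC : C * C = 1 := by rw [hC]; ext i j; fin_cases i <;> fin_cases j <;> simp
  have hc₀inv : ρ c₀⁻¹ = C := by
    calc ρ c₀⁻¹ = ρ c₀⁻¹ * (C * C) := by rw [hCC, mul_one]
      _ = (ρ c₀⁻¹ * ρ c₀) * C := by rw [hCdef, mul_assoc]
      _ = C := by rw [(hinv c₀).2, one_mul]
  obtain ⟨S1, S2, S3⟩ := structure_of_bad hp57 ρ H hHn hdetH c₀ ζ hC hL1 hA hL2
  -- S4: `ρ(H) ⊆ {±1}` is impossible (monomial ⇒ diagonal ⇒ reducible)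
  have hzt : z 0 0 + z 1 1 = 4 ∨ z 0 0 + z 1 1 = -4 := by
    have := hA 1 H.one_mem; rwa [map_one, mul_one] at this
  have hzt0 : z 0 0 + z 1 1 ≠ 0 := by
    rcases hzt with h | h <;> rw [h]
    · exact h4
    · exact neg_ne_zero.mpr h4
  have S4 : ¬ (∀ h ∈ H, ρ h = 1 ∨ ρ h = -1) := by
    intro hall
    -- every `ρ g` is diagonal or antidiagonal
    have hshape : ∀ g : G, (ρ g 1 0 = 0 ∧ ρ g 0 1 = 0) ∨ (ρ g 0 0 = 0 ∧ ρ g 1 1 = 0) := by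
      intro g
      have hk := hall _ (hHc c₀ g)
      rw [map_mul, map_mul, map_mul, hc₀inv, ← hCdef] at hk
      -- `C X C X' = ±1` ⇒ `C X C = ±X`
      have hX : C * ρ g * C = ρ g ∨ C * ρ g * C = -ρ g := by
        rcases hk with hk | hk
        · left
          calc C * ρ g * C = C * ρ g * C * (ρ g⁻¹ * ρ g) := by rw [(hinv g).2, mul_one]
            _ = (C * ρ g * C * ρ g⁻¹) * ρ g := by simp only [mul_assoc]
            _ = ρ g := by rw [hk, one_mul]
        · right
          calc C * ρ g * C = C * ρ g * C * (ρ g⁻¹ * ρ g) := by rw [(hinv g).2, mul_one]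
            _ = (C * ρ g * C * ρ g⁻¹) * ρ g := by simp only [mul_assoc]
            _ = -ρ g := by rw [hk, neg_one_mul]
      rcases hX with hX | hX
      · left
        have e10 := congr_fun (congr_fun hX 1) 0
        have e01 := congr_fun (congr_fun hX 0) 1
        simp only [Matrix.mul_apply, Fin.sum_univ_two, hC00, hC01, hC10, hC11, one_mul, mul_one, zero_mul,
          mul_zero, add_zero, zero_add, mul_neg, neg_mul] at e10 e01
        constructor
        · have : (2 : ZMod p) * ρ g 1 0 = 0 := by linear_combination -e10
          exact (mul_eq_zero.mp this).resolve_left h2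
        · have : (2 : ZMod p) * ρ g 0 1 = 0 := by linear_combination -e01
          exact (mul_eq_zero.mp this).resolve_left h2
      · right
        have e00 := congr_fun (congr_fun hX 0) 0
        have e11 := congr_fun (congr_fun hX 1) 1
        simp only [Matrix.mul_apply, Fin.sum_univ_two, hC00, hC01, hC10, hC11, one_mul, mul_one, zero_mul,
          mul_zero, add_zero, zero_add, mul_neg, neg_mul, neg_neg, Matrix.neg_apply] at e00 e11
        constructor
        · have : (2 : ZMod p) * ρ g 0 0 = 0 := by linear_combination e00
          exact (mul_eq_zero.mp this).resolve_left h2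
        · have : (2 : ZMod p) * ρ g 1 1 = 0 := by linear_combination e11
          exact (mul_eq_zero.mp this).resolve_left h2
    -- `z` is diagonal (its trace is `±4 ≠ 0`)
    have hzd : z 1 0 = 0 ∧ z 0 1 = 0 := by
      rcases hshape ζ with h | h
      · exact h
      · exact absurd (by rw [hz, h.1, h.2, add_zero]) hzt0
    have hCd : C 1 0 = 0 ∧ C 0 1 = 0 := ⟨hC10, hC01⟩
    -- every `ρ g` is diagonal
    obtain ⟨g, hg⟩ := hL1
    obtain ⟨a, b, h, hh, hg'⟩ := hgen g
    have hd : (ρ g) 1 0 = 0 ∧ (ρ g) 0 1 = 0 := by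
      rw [hg', map_mul, map_mul, map_pow, map_pow]
      refine diag_mul (diag_mul (diag_pow hzd a) (diag_pow hCd b)) ?_
      rcases hall h hh with h1 | h1 <;> rw [h1] <;> simp
    exact hg hd.1
  -- S5: a trace-zero element `j ∈ ρ(H)`
  obtain ⟨hj, hhj, hjt⟩ : ∃ hj ∈ H, (ρ hj) 0 0 + (ρ hj) 1 1 = 0 := by
    by_contra hno
    push Not at hno
    exact S4 fun h hh ↦ by
      rcases S1 h hh with h0 | h2' | hm2
      · exact absurd h0 (hno h hh)
      · exact Or.inl (S2 h hh h2')
      · exact Or.inr (S3 h hh hm2)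
  set j := ρ hj with hjdef
  have hjj : j * j = -1 := mul_self_eq_neg_one_of_trace_zero j hjt (hdetH hj hhj)
  have hjinv : ρ hj⁻¹ = -j := by rw [hρinv hj hhj, ← hjdef, hjt, zero_smul, zero_sub]
  -- S6: `z` commutes with every trace-zero `J ∈ ρ(H)`
  have hzinv : ρ ζ⁻¹ * z = 1 := (hinv ζ).2
  have hzinv' : z * ρ ζ⁻¹ = 1 := (hinv ζ).1
  have hζinv : (3 : ZMod p) • ρ ζ⁻¹ = (z 0 0 + z 1 1) • (1 : Matrix (Fin 2) (Fin 2) (ZMod p)) - z := by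
    have hch := mul_self_eq_fin_two z
    rw [hdetz] at hch
    -- `z (tz - z) = 3`, so `tz - z = 3 z⁻¹`
    have e1 : z * ((z 0 0 + z 1 1) • (1 : Matrix (Fin 2) (Fin 2) (ZMod p)) - z) = (3 : ZMod p) • 1 := by
      rw [Matrix.mul_sub, Matrix.mul_smul, Matrix.mul_one, hch]; abel
    calc (3 : ZMod p) • ρ ζ⁻¹ = ρ ζ⁻¹ * ((3 : ZMod p) • 1) := by rw [Matrix.mul_smul, Matrix.mul_one]
      _ = ρ ζ⁻¹ * (z * ((z 0 0 + z 1 1) • 1 - z)) := by rw [e1]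
      _ = (ρ ζ⁻¹ * z) * ((z 0 0 + z 1 1) • 1 - z) := by rw [Matrix.mul_assoc]
      _ = _ := by rw [hzinv, Matrix.one_mul]
  have S6 : ∀ h' ∈ H, (ρ h') 0 0 + (ρ h') 1 1 = 0 → z * ρ h' = ρ h' * z := by
    intro h' hh' hJt
    set J := ρ h' with hJdef
    have hJJ : J * J = -1 := mul_self_eq_neg_one_of_trace_zero J hJt (hdetH h' hh')
    have hzJ := hA h' hh'
    -- the element `h' (ζ h' ζ⁻¹) ∈ H` and its trace
    have hmem : h' * (ζ * h' * ζ⁻¹) ∈ H := H.mul_mem hh' (hHn ζ h' hh')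
    have h3tr : (3 : ZMod p) * ((ρ (h' * (ζ * h' * ζ⁻¹))) 0 0 + (ρ (h' * (ζ * h' * ζ⁻¹))) 1 1) = -26 := by
      have e := trace_j_z_j_adj J z hJt (hdetH h' hh') hdetz
      rw [← hζinv, Matrix.mul_smul, Matrix.smul_apply, Matrix.smul_apply, smul_eq_mul, smul_eq_mul,
        ← mul_add] at e
      rw [map_mul, map_mul, map_mul, ← hJdef, ← hz, ← Matrix.mul_assoc, ← Matrix.mul_assoc, e]
      rcases hzt with h | h <;> rcases hzJ with h' | h' <;> rw [h, h'] <;> norm_num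
    have htr := S1 _ hmem
    have htm2 : (ρ (h' * (ζ * h' * ζ⁻¹))) 0 0 + (ρ (h' * (ζ * h' * ζ⁻¹))) 1 1 = -2 := by
      rcases htr with h | h | h
      · rw [h, mul_zero] at h3tr; exact absurd (by linear_combination h3tr) h26
      · rw [h] at h3tr; exact absurd (by linear_combination h3tr) h32
      · exact h
    have hm1 := S3 _ hmem htm2
    rw [map_mul, map_mul, map_mul, ← hJdef, ← hz] at hm1
    -- `J z J z⁻¹ = -1` ⇒ `J z J = -z` ⇒ `z J = J z`
    have e2 : J * z * J = -z := by
      calc J * z * J = J * (z * J * ρ ζ⁻¹) * z := by simp only [Matrix.mul_assoc, hzinv, Matrix.mul_one]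
        _ = -z := by rw [hm1, neg_one_mul]
    calc z * J = -(J * J) * (z * J) := by rw [hJJ, neg_neg, Matrix.one_mul]
      _ = -(J * (J * z * J)) := by simp only [Matrix.mul_assoc, neg_mul]
      _ = J * z := by rw [e2, Matrix.mul_neg, neg_neg]
  have hzj : z * j = j * z := S6 hj hhj hjt
  -- S7: trace-zero elements of `ρ(H)` are `±j`
  have S7 : ∀ h' ∈ H, (ρ h') 0 0 + (ρ h') 1 1 = 0 → ρ h' = j ∨ ρ h' = -j := by
    intro h' hh' hJt
    set J := ρ h' with hJdef
    have hJJ : J * J = -1 := mul_self_eq_neg_one_of_trace_zero J hJt (hdetH h' hh')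
    have hmem : hj * h' ∈ H := H.mul_mem hhj hh'
    rcases S1 _ hmem with h0 | h2' | hm2
    · -- `j J = -J j`: then `tr(z j) = 0`, contradicting `hA`
      exfalso
      rw [map_mul, ← hjdef, ← hJdef] at h0
      have hanti := mul_add_mul_of_trace_zero j J hjt hJt
      rw [h0, zero_smul] at hanti
      have hzJ : z * J = J * z := S6 h' hh' hJt
      -- `J (z j) (-J) = z · (J j (-J)) = -(z j)` up to `J² = -1`
      have e1 : J * (z * j) * (-J) = -(z * j) := by
        have : J * j = -(j * J) := eq_neg_of_add_eq_zero_right hanti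
        calc J * (z * j) * (-J) = -(J * z * j * J) := by simp only [Matrix.mul_assoc, Matrix.mul_neg]
          _ = -(z * J * j * J) := by rw [← hzJ]
          _ = -(z * (-(j * J)) * J) := by rw [Matrix.mul_assoc z J j, this]
          _ = z * j * (J * J) := by simp only [Matrix.mul_neg, Matrix.neg_mul, neg_neg, Matrix.mul_assoc]
          _ = -(z * j) := by rw [hJJ, Matrix.mul_neg, Matrix.mul_one]
      have htr := trace_conj_eq J (z * j) (-J) (by rw [Matrix.neg_mul, hJJ, neg_neg])
      rw [e1, Matrix.neg_apply, Matrix.neg_apply] at htr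
      have hzjt : (z * j) 0 0 + (z * j) 1 1 = 4 ∨ (z * j) 0 0 + (z * j) 1 1 = -4 := hA hj hhj
      have : (2 : ZMod p) * ((z * j) 0 0 + (z * j) 1 1) = 0 := by linear_combination -htr
      rcases mul_eq_zero.mp this with h | h
      · exact h2 h
      · rcases hzjt with h' | h' <;> rw [h'] at h
        · exact h4 h
        · exact h4 (neg_eq_zero.mp h)
    · right
      have h1 := S2 _ hmem h2'
      rw [map_mul, ← hjdef, ← hJdef] at h1
      calc J = -(j * j) * J := by rw [hjj, neg_neg, Matrix.one_mul]
        _ = -(j * (j * J)) := by rw [neg_mul, Matrix.mul_assoc]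
        _ = -j := by rw [h1, Matrix.mul_one]
    · left
      have h1 := S3 _ hmem hm2
      rw [map_mul, ← hjdef, ← hJdef] at h1
      calc J = -(j * j) * J := by rw [hjj, neg_neg, Matrix.one_mul]
        _ = -(j * (j * J)) := by rw [neg_mul, Matrix.mul_assoc]
        _ = j := by rw [h1, Matrix.mul_neg, Matrix.mul_one, neg_neg]
  -- S8: `C j C = ±j`
  have hCjC := S7 _ (hHn c₀ hj hhj) (by
    rw [map_mul, map_mul, hc₀inv, ← hCdef, ← hjdef, trace_conj_eq C j C hCC]; exact hjt)
  rw [map_mul, map_mul, hc₀inv, ← hCdef, ← hjdef] at hCjC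
  rcases hCjC with hcomm | hanti
  · -- `C j = j C`: `j` diagonal, `j₀₀² = -1`, then `z` diagonal, `ρ(G)` diagonal
    have hCj : C * j = j * C := by
      calc C * j = C * j * (C * C) := by rw [hCC, mul_one]
        _ = (C * j * C) * C := by rw [← Matrix.mul_assoc]
        _ = j * C := by rw [hcomm]
    have e01 := congr_fun (congr_fun hCj 0) 1
    have e10 := congr_fun (congr_fun hCj 1) 0
    simp only [Matrix.mul_apply, Fin.sum_univ_two, hC00, hC01, hC10, hC11, one_mul, mul_one, zero_mul,
      mul_zero, add_zero, zero_add, mul_neg, neg_mul] at e01 e10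
    have hj01 : j 0 1 = 0 := by
      have : (2 : ZMod p) * j 0 1 = 0 := by linear_combination e01
      exact (mul_eq_zero.mp this).resolve_left h2
    have hj10 : j 1 0 = 0 := by
      have : (2 : ZMod p) * j 1 0 = 0 := by linear_combination -e10
      exact (mul_eq_zero.mp this).resolve_left h2
    have hj11 : j 1 1 = -j 0 0 := by linear_combination hjt
    have hsq : j 0 0 * j 0 0 = -1 := by
      have := congr_fun (congr_fun hjj 0) 0
      simpa [Matrix.mul_apply, Fin.sum_univ_two, hj01] using this
    have hj00 : j 0 0 ≠ 0 := fun h0 ↦ by rw [h0, mul_zero] at hsq; exact one_ne_zero (neg_eq_zero.mp hsq.symm)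
    -- `z` diagonal
    have ez01 := congr_fun (congr_fun hzj 0) 1
    have ez10 := congr_fun (congr_fun hzj 1) 0
    simp [Matrix.mul_apply, Fin.sum_univ_two, hj01, hj10, hj11] at ez01 ez10
    have hz01 : z 0 1 = 0 := by
      have : (2 : ZMod p) * j 0 0 * z 0 1 = 0 := by linear_combination -ez01
      rcases mul_eq_zero.mp this with h | h
      · exact absurd ((mul_eq_zero.mp h).resolve_left h2) hj00
      · exact h
    have hz10 : z 1 0 = 0 := by
      have : (2 : ZMod p) * j 0 0 * z 1 0 = 0 := by linear_combination ez10
      rcases mul_eq_zero.mp this with h | h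
      · exact absurd ((mul_eq_zero.mp h).resolve_left h2) hj00
      · exact h
    -- every `ρ h`, `h ∈ H`, is diagonal (`±1` or `±j`)
    have hHd : ∀ h ∈ H, (ρ h) 1 0 = 0 ∧ (ρ h) 0 1 = 0 := by
      intro h hh
      rcases S1 h hh with h0 | h2' | hm2
      · rcases S7 h hh h0 with e | e <;> rw [e] <;> simp [hj01, hj10]
      · rw [S2 h hh h2']; simp
      · rw [S3 h hh hm2]; simp
    obtain ⟨g, hg⟩ := hL1
    obtain ⟨a, b, h, hh, hg'⟩ := hgen g
    have hd : (ρ g) 1 0 = 0 ∧ (ρ g) 0 1 = 0 := by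
      rw [hg', map_mul, map_mul, map_pow, map_pow]
      exact diag_mul (diag_mul (diag_pow ⟨hz10, hz01⟩ a) (diag_pow ⟨hC10, hC01⟩ b)) (hHd h hh)
    exact hg hd.1
  · -- `C j C = -j`: then `tr(z C) = 0`, contradicting `hB`
    have hCj : C * j = -(j * C) := by
      calc C * j = C * j * (C * C) := by rw [hCC, mul_one]
        _ = (C * j * C) * C := by rw [← Matrix.mul_assoc]
        _ = -(j * C) := by rw [hanti, Matrix.neg_mul]
    have e1 : j * (z * C) * (-j) = -(z * C) := by
      calc j * (z * C) * (-j) = -(j * z * C * j) := by simp only [Matrix.mul_assoc, Matrix.mul_neg]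
        _ = -(z * j * C * j) := by rw [← hzj]
        _ = -(z * (j * C) * j) := by rw [Matrix.mul_assoc z j C]
        _ = (z * (C * j) * j) := by rw [hCj]; simp only [Matrix.mul_neg, Matrix.neg_mul]
        _ = z * C * (j * j) := by simp only [Matrix.mul_assoc]
        _ = -(z * C) := by rw [hjj, Matrix.mul_neg, Matrix.mul_one]
    have htr := trace_conj_eq j (z * C) (-j) (by rw [Matrix.neg_mul, hjj, neg_neg])
    rw [e1, Matrix.neg_apply, Matrix.neg_apply] at htr
    have hzC : (z * C) 0 0 + (z * C) 1 1 = 2 ∨ (z * C) 0 0 + (z * C) 1 1 = -2 := by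
      have := hB 1 H.one_mem; rwa [map_one, mul_one] at this
    have : (2 : ZMod p) * ((z * C) 0 0 + (z * C) 1 1) = 0 := by linear_combination -htr
    rcases mul_eq_zero.mp this with h | h
    · exact h2 h
    · rcases hzC with h' | h' <;> rw [h'] at h
      · exact h2 h
      · exact h2 (neg_eq_zero.mp h)

end Summit.BirchSwinnertonDyer.BirchSwinnertonDyer.Theorems.LTwistTransfer

end
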